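import Literature.Computability.MetaComplexity.RamseyTautologies
import Literature.Computability.MetaComplexity.FregeBounded
import HarnessLib

/-!
# Bounded-depth `textbookFrege`: a sequent toolkit with line, depth and size accounting

Part 1 of the discharge of `pudlak_ramseyFourPow_depthFrege_upperBound`
(`RamseyTautologiesProofs.lean`): syntactic line classes (`Pc`, `LineOK`), bounded proofs
(`Pf`: the nine rules of `textbookFrege` and Hodel's derived rules with explicit line counts,
following `TextbookFregeCompleteness.lean` line by line), the sequent judgement `Sq Q t L` and
its rules, and the macros (multi-cut, big `∧`/`∨` rules, `¬∧`-weakening). List disjunctions and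
conjunctions are `TextbookFrege.disjList` / `TextbookFrege.conjList` (`FregeBounded.lean`).
All results are proved; no named facts. Sources: Hodel 1995 / Shoenfield 1967 (the derived
rules), as cited in `TextbookFregeCompleteness.lean`.
-/

namespace Literature.Computability.MetaComplexity

open Complexity Complexity.PropForm

namespace DepthFrege

open TextbookFrege (disjList disjList_nil disjList_cons conjList conjList_nil conjList_cons)


/-! ### L0. Alternation depth of auxiliary positions -/

/-- Auxiliary lemma `altDepthAux_le_altDepth` (bounded-depth Frege toolkit / Pudlák–Krajíček construction, see the section header). [folklore] -/
theorem altDepthAux_le_altDepth (c : ℕ) (ψ : PropForm ℕ) : altDepthAux c ψ ≤ altDepth ψ := by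
  cases ψ with
  | var _ => simp [altDepthAux]
  | const _ => simp [altDepthAux]
  | neg φ =>
    simp only [altDepth, altDepthAux, show (0 : ℕ) ≠ 1 from by decide, if_false]
    split_ifs <;> omega
  | conj φ χ =>
    simp only [altDepth, altDepthAux, show (0 : ℕ) ≠ 2 from by decide, if_false]
    split_ifs <;> omega
  | disj φ χ =>
    simp only [altDepth, altDepthAux, show (0 : ℕ) ≠ 3 from by decide, if_false]
    split_ifs <;> omega

/-- Parameters of the line classes: base depth `D`, base size `M`, leaf budget `Λ`. [folklore] -/
structure Prm where
  /-- depth bound of base formulas -/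
  D : ℕ
  /-- size bound of base formulas -/
  M : ℕ
  /-- leaf budget of a line -/
  Λ : ℕ

/-- Syntactic line classes: level `k` (negation nesting above base formulas) and `n` leaves. [folklore] -/
inductive Pc (P : Prm) : ℕ → ℕ → PropForm ℕ → Prop
  /-- `base` -/
  | base {u : PropForm ℕ} : u.altDepth ≤ P.D → u.size ≤ P.M → Pc P 0 1 u
  /-- `bot` -/
  | bot : Pc P 0 1 (const false)
  /-- `disj` -/
  | disj {k₁ n₁ k₂ n₂ : ℕ} {a b : PropForm ℕ} :
      Pc P k₁ n₁ a → Pc P k₂ n₂ b → Pc P (max k₁ k₂) (n₁ + n₂) (disj a b)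
  /-- `neg` -/
  | neg {k n : ℕ} {a : PropForm ℕ} : Pc P k n a → Pc P (k + 1) n (neg a)

variable {P : Prm}

/-- Auxiliary lemma `Pc.one_le` (bounded-depth Frege toolkit / Pudlák–Krajíček construction, see the section header). [folklore] -/
theorem Pc.one_le {k n : ℕ} {ψ : PropForm ℕ} (h : Pc P k n ψ) : 1 ≤ n := by
  induction h with
  | base _ _ => exact le_rfl
  | bot => exact le_rfl
  | disj _ _ ih₁ _ => omega
  | neg _ ih => exact ih

/-- Auxiliary lemma `Pc.depthAux_le` (bounded-depth Frege toolkit / Pudlák–Krajíček construction, see the section header). [folklore] -/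
theorem Pc.depthAux_le {k n : ℕ} {ψ : PropForm ℕ} (h : Pc P k n ψ) :
    altDepthAux 3 ψ ≤ P.D + 2 * k + 1 ∧ ∀ c, altDepthAux c ψ ≤ P.D + 2 * k + 2 := by
  induction h with
  | base hd _ =>
    exact ⟨(altDepthAux_le_altDepth 3 _).trans (by omega),
      fun c => (altDepthAux_le_altDepth c _).trans (by omega)⟩
  | bot => simp [altDepthAux]
  | @disj k₁ n₁ k₂ n₂ a b _ _ ih₁ ih₂ =>
    have h₁ := ih₁.1
    have h₂ := ih₂.1
    have hm₁ : k₁ ≤ max k₁ k₂ := le_max_left _ _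
    have hm₂ : k₂ ≤ max k₁ k₂ := le_max_right _ _
    refine ⟨?_, fun c => ?_⟩
    · simp only [altDepthAux, if_true]
      omega
    · simp only [altDepthAux]
      split_ifs <;> omega
  | @neg k n a _ ih =>
    have h₁ := ih.2 1
    refine ⟨?_, fun c => ?_⟩
    · simp only [altDepthAux]
      split_ifs <;> omega
    · simp only [altDepthAux]
      split_ifs <;> omega

/-- Auxiliary lemma `Pc.altDepth_le` (bounded-depth Frege toolkit / Pudlák–Krajíček construction, see the section header). [folklore] -/
theorem Pc.altDepth_le {k n : ℕ} {ψ : PropForm ℕ} (h : Pc P k n ψ) :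
    ψ.altDepth ≤ P.D + 2 * k + 2 :=
  (h.depthAux_le).2 0

/-- Auxiliary lemma `Pc.size_le` (bounded-depth Frege toolkit / Pudlák–Krajíček construction, see the section header). [folklore] -/
theorem Pc.size_le {k n : ℕ} {ψ : PropForm ℕ} (h : Pc P k n ψ) :
    ψ.size + 1 ≤ n * (P.M + 2 + k) := by
  induction h with
  | base _ hs => simp; omega
  | bot => simp [size]
  | @disj k₁ n₁ k₂ n₂ a b ha hb ih₁ ih₂ =>
    have e₁ : n₁ * (P.M + 2 + k₁) ≤ n₁ * (P.M + 2 + max k₁ k₂) :=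
      Nat.mul_le_mul_left _ (by have := le_max_left k₁ k₂; omega)
    have e₂ : n₂ * (P.M + 2 + k₂) ≤ n₂ * (P.M + 2 + max k₁ k₂) :=
      Nat.mul_le_mul_left _ (by have := le_max_right k₁ k₂; omega)
    simp only [size]
    have : (n₁ + n₂) * (P.M + 2 + max k₁ k₂) =
        n₁ * (P.M + 2 + max k₁ k₂) + n₂ * (P.M + 2 + max k₁ k₂) := Nat.add_mul _ _ _
    omega
  | @neg k n a ha ih =>
    have h1 := ha.one_le
    simp only [size]
    have : n * (P.M + 2 + (k + 1)) = n * (P.M + 2 + k) + n := by ring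
    omega

/-- Admissible lines: level at most `12`, at most `Λ` leaves. [folklore] -/
def LineOK (P : Prm) (ψ : PropForm ℕ) : Prop :=
  ∃ k n, Pc P k n ψ ∧ k ≤ 12 ∧ n ≤ P.Λ

/-- Auxiliary lemma `LineOK.altDepth_le` (bounded-depth Frege toolkit / Pudlák–Krajíček construction, see the section header). [folklore] -/
theorem LineOK.altDepth_le {ψ : PropForm ℕ} (h : LineOK P ψ) : ψ.altDepth ≤ P.D + 26 := by
  obtain ⟨k, n, hp, hk, _⟩ := h
  have := hp.altDepth_le
  omega

/-- Auxiliary lemma `LineOK.size_le` (bounded-depth Frege toolkit / Pudlák–Krajíček construction, see the section header). [folklore] -/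
theorem LineOK.size_le {ψ : PropForm ℕ} (h : LineOK P ψ) : ψ.size + 1 ≤ P.Λ * (P.M + 14) := by
  obtain ⟨k, n, hp, hk, hn⟩ := h
  have := hp.size_le
  calc ψ.size + 1 ≤ n * (P.M + 2 + k) := this
    _ ≤ P.Λ * (P.M + 14) := Nat.mul_le_mul hn (by omega)

/-- Auxiliary lemma `LineOK.mk'` (bounded-depth Frege toolkit / Pudlák–Krajíček construction, see the section header). [folklore] -/
theorem LineOK.mk' {k n : ℕ} {ψ : PropForm ℕ} (h : Pc P k n ψ) (hk : k ≤ 12) (hn : n ≤ P.Λ) :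
    LineOK P ψ := ⟨k, n, h, hk, hn⟩

/-! ### L0. Bounded proofs -/

/-- `Pf P ℓ φ`: `φ` occurs in a hypothesis-free `textbookFrege` derivation with at most `ℓ`
lines, all admissible. [folklore] -/
def Pf (P : Prm) (ℓ : ℕ) (φ : PropForm ℕ) : Prop :=
  ∃ π : List (PropForm ℕ), textbookFrege.IsDerivation ∅ π ∧ φ ∈ π ∧ π.length ≤ ℓ ∧
    ∀ ψ ∈ π, LineOK P ψ

/-- Auxiliary lemma `Pf.mono` (bounded-depth Frege toolkit / Pudlák–Krajíček construction, see the section header). [folklore] -/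
theorem Pf.mono {ℓ ℓ' : ℕ} {φ : PropForm ℕ} (h : Pf P ℓ φ) (hℓ : ℓ ≤ ℓ') : Pf P ℓ' φ := by
  obtain ⟨π, h₁, h₂, h₃, h₄⟩ := h
  exact ⟨π, h₁, h₂, h₃.trans hℓ, h₄⟩

/-- Auxiliary lemma `Pf.lineOK` (bounded-depth Frege toolkit / Pudlák–Krajíček construction, see the section header). [folklore] -/
theorem Pf.lineOK {ℓ : ℕ} {φ : PropForm ℕ} (h : Pf P ℓ φ) : LineOK P φ := by
  obtain ⟨π, _, h₂, _, h₄⟩ := h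
  exact h₄ φ h₂

/-- Auxiliary lemma `isDerivation_snoc` (bounded-depth Frege toolkit / Pudlák–Krajíček construction, see the section header). [folklore] -/
theorem isDerivation_snoc {F : FregeSystem} {π : List (PropForm ℕ)} {θ : PropForm ℕ}
    (hπ : F.IsDerivation ∅ π) (hθ : F.IsInferred π θ) : F.IsDerivation ∅ (π ++ [θ]) := by
  intro k hk
  rw [List.length_append, List.length_singleton] at hk
  by_cases hk' : k < π.length
  · rw [List.getElem_append_left hk', List.take_append_of_le_length hk'.le]
    exact hπ k hk'
  · have hkeq : k = π.length := by omega
    have htake : (π ++ [θ]).take k = π := by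
      rw [List.take_append_of_le_length (by omega), hkeq, List.take_length]
    rw [List.getElem_concat_length hkeq, htake]
    exact Or.inr hθ

/-- Generic inference step: if all premise instances of a rule are provable (jointly within a
derivation assembled from the given ones), the conclusion instance is provable. [folklore] -/
theorem Pf.infer {r : FregeRule} (hr : r ∈ textbookFrege.rules) (σ : ℕ → PropForm ℕ)
    {ℓ : ℕ} (hprem : ∃ π : List (PropForm ℕ), textbookFrege.IsDerivation ∅ π ∧ π.length ≤ ℓ ∧
      (∀ ψ ∈ π, LineOK P ψ) ∧ ∀ p ∈ r.premises, p.subst σ ∈ π)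
    (hok : LineOK P (r.conclusion.subst σ)) : Pf P (ℓ + 1) (r.conclusion.subst σ) := by
  obtain ⟨π, hπ, hlen, hlines, hmem⟩ := hprem
  refine ⟨π ++ [r.conclusion.subst σ], isDerivation_snoc hπ ⟨r, hr, σ, rfl, hmem⟩, by simp,
    by simp [hlen], ?_⟩
  intro ψ hψ
  rw [List.mem_append, List.mem_singleton] at hψ
  rcases hψ with hψ | rfl
  · exact hlines ψ hψ
  · exact hok

open TextbookFrege (sub3)

variable {a b c : PropForm ℕ} {ℓ ℓ₁ ℓ₂ : ℕ}

/-- Auxiliary lemma `ax` (bounded-depth Frege toolkit / Pudlák–Krajíček construction, see the section header). [folklore] -/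
theorem ax (a : PropForm ℕ) (hok : LineOK P (disj (neg a) a)) : Pf P 1 (disj (neg a) a) :=
  Pf.infer (r := ⟨[], disj (neg (var 0)) (var 0)⟩) (by simp [textbookFrege]) (sub3 a a a)
    (ℓ := 0) ⟨[], FregeSystem.isDerivation_nil _ _, le_rfl, by simp, by simp⟩ hok

/-- Auxiliary lemma `expan` (bounded-depth Frege toolkit / Pudlák–Krajíček construction, see the section header). [folklore] -/
theorem expan (b : PropForm ℕ) (h : Pf P ℓ a) (hok : LineOK P (disj b a)) :
    Pf P (ℓ + 1) (disj b a) := by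
  obtain ⟨π, hπ, hmem, hlen, hl⟩ := h
  exact Pf.infer (r := ⟨[var 0], disj (var 1) (var 0)⟩) (by simp [textbookFrege]) (sub3 a b b)
    ⟨π, hπ, hlen, hl, by simpa [subst, sub3] using hmem⟩ hok

/-- Auxiliary lemma `contr` (bounded-depth Frege toolkit / Pudlák–Krajíček construction, see the section header). [folklore] -/
theorem contr (h : Pf P ℓ (disj a a)) (hok : LineOK P a) : Pf P (ℓ + 1) a := by
  obtain ⟨π, hπ, hmem, hlen, hl⟩ := h
  exact Pf.infer (r := ⟨[disj (var 0) (var 0)], var 0⟩) (by simp [textbookFrege]) (sub3 a a a)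
    ⟨π, hπ, hlen, hl, by simpa [subst, sub3] using hmem⟩ hok

/-- Auxiliary lemma `assoc` (bounded-depth Frege toolkit / Pudlák–Krajíček construction, see the section header). [folklore] -/
theorem assoc (h : Pf P ℓ (disj a (disj b c))) (hok : LineOK P (disj (disj a b) c)) :
    Pf P (ℓ + 1) (disj (disj a b) c) := by
  obtain ⟨π, hπ, hmem, hlen, hl⟩ := h
  exact Pf.infer (r := ⟨[disj (var 0) (disj (var 1) (var 2))], disj (disj (var 0) (var 1)) (var 2)⟩)
    (by simp [textbookFrege]) (sub3 a b c) ⟨π, hπ, hlen, hl, by simpa [subst, sub3] using hmem⟩ hok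

/-- Auxiliary lemma `cut` (bounded-depth Frege toolkit / Pudlák–Krajíček construction, see the section header). [folklore] -/
theorem cut (h₁ : Pf P ℓ₁ (disj a b)) (h₂ : Pf P ℓ₂ (disj (neg a) c))
    (hok : LineOK P (disj b c)) : Pf P (ℓ₁ + ℓ₂ + 1) (disj b c) := by
  obtain ⟨π₁, hπ₁, hmem₁, hlen₁, hl₁⟩ := h₁
  obtain ⟨π₂, hπ₂, hmem₂, hlen₂, hl₂⟩ := h₂
  refine Pf.infer (r := ⟨[disj (var 0) (var 1), disj (neg (var 0)) (var 2)], disj (var 1) (var 2)⟩)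
    (by simp [textbookFrege]) (sub3 a b c) ⟨π₁ ++ π₂, hπ₁.append hπ₂, by simp; omega, ?_, ?_⟩ hok
  · intro ψ hψ
    rcases List.mem_append.1 hψ with h | h
    · exact hl₁ ψ h
    · exact hl₂ ψ h
  · intro p hp
    simp only [List.mem_cons, List.not_mem_nil, or_false] at hp
    rcases hp with rfl | rfl
    · simpa [subst, sub3] using List.mem_append_left π₂ hmem₁
    · simpa [subst, sub3] using List.mem_append_right π₁ hmem₂

/-- Auxiliary lemma `conjAx₁` (bounded-depth Frege toolkit / Pudlák–Krajíček construction, see the section header). [folklore] -/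
theorem conjAx₁ (a b : PropForm ℕ)
    (hok : LineOK P (disj (neg (conj a b)) (neg (disj (neg a) (neg b))))) :
    Pf P 1 (disj (neg (conj a b)) (neg (disj (neg a) (neg b)))) :=
  Pf.infer (r := ⟨[], disj (neg (conj (var 0) (var 1))) (neg (disj (neg (var 0)) (neg (var 1))))⟩)
    (by simp [textbookFrege]) (sub3 a b b) (ℓ := 0)
    ⟨[], FregeSystem.isDerivation_nil _ _, le_rfl, by simp, by simp⟩ hok

/-- Auxiliary lemma `conjAx₂` (bounded-depth Frege toolkit / Pudlák–Krajíček construction, see the section header). [folklore] -/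
theorem conjAx₂ (a b : PropForm ℕ)
    (hok : LineOK P (disj (neg (neg (disj (neg a) (neg b)))) (conj a b))) :
    Pf P 1 (disj (neg (neg (disj (neg a) (neg b)))) (conj a b)) :=
  Pf.infer (r := ⟨[], disj (neg (neg (disj (neg (var 0)) (neg (var 1))))) (conj (var 0) (var 1))⟩)
    (by simp [textbookFrege]) (sub3 a b b) (ℓ := 0)
    ⟨[], FregeSystem.isDerivation_nil _ _, le_rfl, by simp, by simp⟩ hok

/-- Auxiliary lemma `top` (bounded-depth Frege toolkit / Pudlák–Krajíček construction, see the section header). [folklore] -/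
theorem top (hM : 1 ≤ P.M) (hΛ : 1 ≤ P.Λ) : Pf P 1 (const true) :=
  Pf.infer (r := ⟨[], const true⟩) (by simp [textbookFrege])
    (sub3 (const true) (const true) (const true)) (ℓ := 0)
    ⟨[], FregeSystem.isDerivation_nil _ _, le_rfl, by simp, by simp⟩
    ⟨0, 1, Pc.base (by simp [subst, altDepth]) (by simpa [subst, size] using hM),
      by omega, hΛ⟩

/-- Auxiliary lemma `negBot` (bounded-depth Frege toolkit / Pudlák–Krajíček construction, see the section header). [folklore] -/
theorem negBot (hΛ : 1 ≤ P.Λ) : Pf P 1 (neg (const false)) :=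
  Pf.infer (r := ⟨[], neg (const false)⟩) (by simp [textbookFrege])
    (sub3 (const true) (const true) (const true)) (ℓ := 0)
    ⟨[], FregeSystem.isDerivation_nil _ _, le_rfl, by simp, by simp⟩
    ⟨1, 1, Pc.neg Pc.bot, by omega, hΛ⟩

/-! ### L1. Derived rules with line counts -/

section L1

variable {ka kb kc kd na nb nc nd : ℕ} {d : PropForm ℕ}

/-- `A ∨ B ⊢ B ∨ A` (2 lines). [folklore] -/
theorem comm (h : Pf P ℓ (disj a b)) (ha : Pc P ka na a) (hb : Pc P kb nb b)
    (hk : ka ≤ 11) (hk' : kb ≤ 12) (hn : 2 * na + nb ≤ P.Λ) : Pf P (ℓ + 2) (disj b a) := by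
  have h1 := ax a (P := P) (by apply LineOK.mk'; (repeat (first | assumption | exact Pc.bot | apply Pc.disj | apply Pc.neg)); all_goals omega)
  have h2 := cut h h1 (by apply LineOK.mk'; (repeat (first | assumption | exact Pc.bot | apply Pc.disj | apply Pc.neg)); all_goals omega)
  exact h2.mono (by omega)

/-- `A ⊢ A ∨ B` (3 lines). [folklore] -/
theorem expan' (b : PropForm ℕ) (h : Pf P ℓ a) (ha : Pc P ka na a) (hb : Pc P kb nb b)
    (hk : ka ≤ 12) (hk' : kb ≤ 11) (hn : na + 2 * nb ≤ P.Λ) : Pf P (ℓ + 3) (disj a b) := by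
  have h1 : Pf P (ℓ + 1) (disj b a) := expan b h (by apply LineOK.mk'; (repeat (first | assumption | exact Pc.bot | apply Pc.disj | apply Pc.neg)); all_goals omega)
  have h2 := comm h1 hb ha hk' hk (by omega)
  exact h2.mono (by omega)

/-- `(A ∨ B) ∨ C ⊢ A ∨ (B ∨ C)` (8 lines). [folklore] -/
theorem assoc' (h : Pf P ℓ (disj (disj a b) c)) (ha : Pc P ka na a) (hb : Pc P kb nb b)
    (hc : Pc P kc nc c) (hka : ka ≤ 11) (hkb : kb ≤ 11) (hkc : kc ≤ 11)
    (hn : 2 * (na + nb + nc) ≤ P.Λ) : Pf P (ℓ + 8) (disj a (disj b c)) := by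
  have h1 : Pf P (ℓ + 2) (disj c (disj a b)) := comm h (Pc.disj ha hb) hc (by omega) (by omega) (by omega)
  have h2 : Pf P (ℓ + 3) (disj (disj c a) b) := assoc h1 (by apply LineOK.mk'; (repeat (first | assumption | exact Pc.bot | apply Pc.disj | apply Pc.neg)); all_goals omega)
  have h3 : Pf P (ℓ + 5) (disj b (disj c a)) := comm h2 (Pc.disj hc ha) hb (by omega) (by omega) (by omega)
  have h4 : Pf P (ℓ + 6) (disj (disj b c) a) := assoc h3 (by apply LineOK.mk'; (repeat (first | assumption | exact Pc.bot | apply Pc.disj | apply Pc.neg)); all_goals omega)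
  exact comm h4 (Pc.disj hb hc) ha (by omega) (by omega) (by omega)

/-- `A ∨ B ⊢ ¬¬A ∨ B` (6 lines). [folklore] -/
theorem negNeg (h : Pf P ℓ (disj a b)) (ha : Pc P ka na a) (hb : Pc P kb nb b)
    (hka : ka ≤ 9) (hkb : kb ≤ 11) (hn : 3 * na + 2 * nb ≤ P.Λ) :
    Pf P (ℓ + 6) (disj (neg (neg a)) b) := by
  have h1 : Pf P 1 (disj (neg (neg a)) (neg a)) := ax (neg a) (by apply LineOK.mk'; (repeat (first | assumption | exact Pc.bot | apply Pc.disj | apply Pc.neg)); all_goals omega)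
  have h2 : Pf P 3 (disj (neg a) (neg (neg a))) :=
    comm h1 (Pc.neg (Pc.neg ha)) (Pc.neg ha) (by omega) (by omega) (by omega)
  have h3 : Pf P (ℓ + 3 + 1) (disj b (neg (neg a))) := cut h h2 (by apply LineOK.mk'; (repeat (first | assumption | exact Pc.bot | apply Pc.disj | apply Pc.neg)); all_goals omega)
  have h4 := comm h3 hb (Pc.neg (Pc.neg ha)) hkb (by omega) (by omega)
  exact h4.mono (by omega)

/-- `A ∨ B ⊢ A ∨ (C ∨ B)` (6 lines). [folklore] -/
theorem genExp (c : PropForm ℕ) (h : Pf P ℓ (disj a b)) (ha : Pc P ka na a) (hb : Pc P kb nb b)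
    (hc : Pc P kc nc c) (hka : ka ≤ 11) (hkb : kb ≤ 11) (hkc : kc ≤ 11)
    (hn : 2 * (na + nb + nc) ≤ P.Λ) : Pf P (ℓ + 6) (disj a (disj c b)) := by
  have h1 : Pf P (ℓ + 2) (disj b a) := comm h ha hb (by omega) (by omega) (by omega)
  have h2 : Pf P (ℓ + 3) (disj c (disj b a)) := expan c h1 (by apply LineOK.mk'; (repeat (first | assumption | exact Pc.bot | apply Pc.disj | apply Pc.neg)); all_goals omega)
  have h3 : Pf P (ℓ + 4) (disj (disj c b) a) := assoc h2 (by apply LineOK.mk'; (repeat (first | assumption | exact Pc.bot | apply Pc.disj | apply Pc.neg)); all_goals omega)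
  exact comm h3 (Pc.disj hc hb) ha (by omega) (by omega) (by omega)

/-- `A ∨ (B ∨ B) ⊢ A ∨ B` (6 lines). [folklore] -/
theorem genCtn (h : Pf P ℓ (disj a (disj b b))) (ha : Pc P ka na a) (hb : Pc P kb nb b)
    (hka : ka ≤ 11) (hkb : kb ≤ 11) (hn : 2 * na + 3 * nb ≤ P.Λ) : Pf P (ℓ + 6) (disj a b) := by
  have h1 : Pf P (ℓ + 1) (disj (disj a b) b) := assoc h (by apply LineOK.mk'; (repeat (first | assumption | exact Pc.bot | apply Pc.disj | apply Pc.neg)); all_goals omega)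
  have h2 : Pf P (ℓ + 3) (disj b (disj a b)) := comm h1 (Pc.disj ha hb) hb (by omega) (by omega) (by omega)
  have h3 : Pf P (ℓ + 4) (disj a (disj b (disj a b))) := expan a h2 (by apply LineOK.mk'; (repeat (first | assumption | exact Pc.bot | apply Pc.disj | apply Pc.neg)); all_goals omega)
  have h4 : Pf P (ℓ + 5) (disj (disj a b) (disj a b)) := assoc h3 (by apply LineOK.mk'; (repeat (first | assumption | exact Pc.bot | apply Pc.disj | apply Pc.neg)); all_goals omega)
  exact contr h4 (by apply LineOK.mk'; (repeat (first | assumption | exact Pc.bot | apply Pc.disj | apply Pc.neg)); all_goals omega)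

/-- Generalized cut `A ∨ (B ∨ C), A ∨ (¬B ∨ D) ⊢ A ∨ (C ∨ D)` (29 lines). [folklore] -/
theorem genCut (h₁ : Pf P ℓ₁ (disj a (disj b c))) (h₂ : Pf P ℓ₂ (disj a (disj (neg b) d)))
    (ha : Pc P ka na a) (hb : Pc P kb nb b) (hc : Pc P kc nc c) (hd : Pc P kd nd d)
    (hka : ka ≤ 11) (hkb : kb ≤ 10) (hkc : kc ≤ 11) (hkd : kd ≤ 11)
    (hn : 2 * (na + nb + nc + nd) ≤ P.Λ) : Pf P (ℓ₁ + ℓ₂ + 29) (disj a (disj c d)) := by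
  -- (2)–(7): `B ∨ ((C ∨ D) ∨ A)`
  have h3 : Pf P (ℓ₁ + 1) (disj (disj a b) c) := assoc h₁ (by apply LineOK.mk'; (repeat (first | assumption | exact Pc.bot | apply Pc.disj | apply Pc.neg)); all_goals omega)
  have h4 : Pf P (ℓ₁ + 4) (disj (disj (disj a b) c) d) :=
    expan' d h3 (Pc.disj (Pc.disj ha hb) hc) hd (by omega) hkd (by omega)
  have h5 : Pf P (ℓ₁ + 12) (disj (disj a b) (disj c d)) :=
    assoc' h4 (Pc.disj ha hb) hc hd (by omega) hkc hkd (by omega)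
  have h6 : Pf P (ℓ₁ + 14) (disj (disj c d) (disj a b)) :=
    comm h5 (Pc.disj ha hb) (Pc.disj hc hd) (by omega) (by omega) (by omega)
  have h6' : Pf P (ℓ₁ + 15) (disj (disj (disj c d) a) b) := assoc h6 (by apply LineOK.mk'; (repeat (first | assumption | exact Pc.bot | apply Pc.disj | apply Pc.neg)); all_goals omega)
  have h7 : Pf P (ℓ₁ + 17) (disj b (disj (disj c d) a)) :=
    comm h6' (Pc.disj (Pc.disj hc hd) ha) hb (by omega) (by omega) (by omega)
  -- (9)–(14): `¬B ∨ ((C ∨ D) ∨ A)`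
  have h9 : Pf P (ℓ₂ + 1) (disj (disj a (neg b)) d) := assoc h₂ (by apply LineOK.mk'; (repeat (first | assumption | exact Pc.bot | apply Pc.disj | apply Pc.neg)); all_goals omega)
  have h10 : Pf P (ℓ₂ + 3) (disj d (disj a (neg b))) :=
    comm h9 (Pc.disj ha (Pc.neg hb)) hd (by omega) (by omega) (by omega)
  have h11 : Pf P (ℓ₂ + 4) (disj c (disj d (disj a (neg b)))) := expan c h10 (by apply LineOK.mk'; (repeat (first | assumption | exact Pc.bot | apply Pc.disj | apply Pc.neg)); all_goals omega)
  have h12 : Pf P (ℓ₂ + 5) (disj (disj c d) (disj a (neg b))) := assoc h11 (by apply LineOK.mk'; (repeat (first | assumption | exact Pc.bot | apply Pc.disj | apply Pc.neg)); all_goals omega)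
  have h13 : Pf P (ℓ₂ + 6) (disj (disj (disj c d) a) (neg b)) := assoc h12 (by apply LineOK.mk'; (repeat (first | assumption | exact Pc.bot | apply Pc.disj | apply Pc.neg)); all_goals omega)
  have h14 : Pf P (ℓ₂ + 8) (disj (neg b) (disj (disj c d) a)) :=
    comm h13 (Pc.disj (Pc.disj hc hd) ha) (Pc.neg hb) (by omega) (by omega) (by omega)
  -- (15)–(17)
  have h15 : Pf P (ℓ₁ + 17 + (ℓ₂ + 8) + 1)
      (disj (disj (disj c d) a) (disj (disj c d) a)) := cut h7 h14 (by apply LineOK.mk'; (repeat (first | assumption | exact Pc.bot | apply Pc.disj | apply Pc.neg)); all_goals omega)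
  have h16 : Pf P (ℓ₁ + 17 + (ℓ₂ + 8) + 2) (disj (disj c d) a) := contr h15 (by apply LineOK.mk'; (repeat (first | assumption | exact Pc.bot | apply Pc.disj | apply Pc.neg)); all_goals omega)
  have h17 := comm h16 (Pc.disj hc hd) ha (by omega) (by omega) (by omega)
  exact h17.mono (by omega)

/-- Generalized associativity `A ∨ (B ∨ (C ∨ D)) ⊢ A ∨ ((B ∨ C) ∨ D)` (48 lines). [folklore] -/
theorem genAssoc (h : Pf P ℓ (disj a (disj b (disj c d))))
    (ha : Pc P ka na a) (hb : Pc P kb nb b) (hc : Pc P kc nc c) (hd : Pc P kd nd d)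
    (hka : ka ≤ 11) (hkb : kb ≤ 11) (hkc : kc ≤ 11) (hkd : kd ≤ 11)
    (hn : 4 * (na + nb + nc + nd) ≤ P.Λ) : Pf P (ℓ + 48) (disj a (disj (disj b c) d)) := by
  -- (2)–(9): `E ∨ (A ∨ B)` with `E = A ∨ ((B ∨ C) ∨ D)`
  have h2 : Pf P (ℓ + 1) (disj (disj a b) (disj c d)) := assoc h (by apply LineOK.mk'; (repeat (first | assumption | exact Pc.bot | apply Pc.disj | apply Pc.neg)); all_goals omega)
  have h3 : Pf P (ℓ + 3) (disj (disj c d) (disj a b)) :=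
    comm h2 (Pc.disj ha hb) (Pc.disj hc hd) (by omega) (by omega) (by omega)
  have h4 : Pf P (ℓ + 11) (disj c (disj d (disj a b))) :=
    assoc' h3 hc hd (Pc.disj ha hb) hkc hkd (by omega) (by omega)
  have h5 : Pf P (ℓ + 12) (disj b (disj c (disj d (disj a b)))) := expan b h4 (by apply LineOK.mk'; (repeat (first | assumption | exact Pc.bot | apply Pc.disj | apply Pc.neg)); all_goals omega)
  have h6 : Pf P (ℓ + 13) (disj (disj b c) (disj d (disj a b))) := assoc h5 (by apply LineOK.mk'; (repeat (first | assumption | exact Pc.bot | apply Pc.disj | apply Pc.neg)); all_goals omega)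
  have h7 : Pf P (ℓ + 14) (disj (disj (disj b c) d) (disj a b)) := assoc h6 (by apply LineOK.mk'; (repeat (first | assumption | exact Pc.bot | apply Pc.disj | apply Pc.neg)); all_goals omega)
  have h8 : Pf P (ℓ + 15) (disj a (disj (disj (disj b c) d) (disj a b))) := expan a h7 (by apply LineOK.mk'; (repeat (first | assumption | exact Pc.bot | apply Pc.disj | apply Pc.neg)); all_goals omega)
  have h9 : Pf P (ℓ + 16) (disj (disj a (disj (disj b c) d)) (disj a b)) := assoc h8 (by apply LineOK.mk'; (repeat (first | assumption | exact Pc.bot | apply Pc.disj | apply Pc.neg)); all_goals omega)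
  -- (10)–(16)
  have hE : Pc P (max ka (max (max kb kc) kd)) (na + (nb + nc + nd)) (disj a (disj (disj b c) d)) :=
    Pc.disj ha (Pc.disj (Pc.disj hb hc) hd)
  have h10 : Pf P (ℓ + 17) (disj (disj (disj a (disj (disj b c) d)) a) b) := assoc h9 (by apply LineOK.mk'; (repeat (first | assumption | exact Pc.bot | apply Pc.disj | apply Pc.neg)); all_goals omega)
  have h11 : Pf P (ℓ + 20) (disj (disj (disj (disj a (disj (disj b c) d)) a) b) c) :=
    expan' c h10 (Pc.disj (Pc.disj hE ha) hb) hc (by omega) hkc (by omega)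
  have h12 : Pf P (ℓ + 28) (disj (disj (disj a (disj (disj b c) d)) a) (disj b c)) :=
    assoc' h11 (Pc.disj hE ha) hb hc (by omega) hkb hkc (by omega)
  have h13 : Pf P (ℓ + 31) (disj (disj (disj (disj a (disj (disj b c) d)) a) (disj b c)) d) :=
    expan' d h12 (Pc.disj (Pc.disj hE ha) (Pc.disj hb hc)) hd (by omega) hkd (by omega)
  have h14 : Pf P (ℓ + 39) (disj (disj (disj a (disj (disj b c) d)) a) (disj (disj b c) d)) :=
    assoc' h13 (Pc.disj hE ha) (Pc.disj hb hc) hd (by omega) (by omega) hkd (by omega)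
  have h15 : Pf P (ℓ + 47)
      (disj (disj a (disj (disj b c) d)) (disj a (disj (disj b c) d))) :=
    assoc' h14 hE ha (Pc.disj (Pc.disj hb hc) hd) (by omega) hka (by omega) (by omega)
  exact contr h15 (by apply LineOK.mk'; (repeat (first | assumption | exact Pc.bot | apply Pc.disj | apply Pc.neg)); all_goals omega)

/-- Generalized commutativity `A ∨ (B ∨ C) ⊢ A ∨ (C ∨ B)` (31 lines). [folklore] -/
theorem genComm (h : Pf P ℓ (disj a (disj b c))) (ha : Pc P ka na a) (hb : Pc P kb nb b)
    (hc : Pc P kc nc c) (hka : ka ≤ 11) (hkb : kb ≤ 10) (hkc : kc ≤ 11)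
    (hn : 2 * na + 4 * nb + 2 * nc ≤ P.Λ) : Pf P (ℓ + 31) (disj a (disj c b)) := by
  have h1 : Pf P 1 (disj (neg b) b) := ax b (by apply LineOK.mk'; (repeat (first | assumption | exact Pc.bot | apply Pc.disj | apply Pc.neg)); all_goals omega)
  have h2 : Pf P 2 (disj a (disj (neg b) b)) := expan a h1 (by apply LineOK.mk'; (repeat (first | assumption | exact Pc.bot | apply Pc.disj | apply Pc.neg)); all_goals omega)
  have h3 := genCut h h2 ha hb hc hb hka hkb hkc (by omega) (by omega)
  exact h3.mono (by omega)

/-- Generalized new associativity `A ∨ ((B ∨ C) ∨ D) ⊢ A ∨ (B ∨ (C ∨ D))` (189 lines). [folklore] -/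
theorem genAssoc' (h : Pf P ℓ (disj a (disj (disj b c) d)))
    (ha : Pc P ka na a) (hb : Pc P kb nb b) (hc : Pc P kc nc c) (hd : Pc P kd nd d)
    (hka : ka ≤ 11) (hkb : kb ≤ 10) (hkc : kc ≤ 10) (hkd : kd ≤ 10)
    (hn : 4 * (na + nb + nc + nd) ≤ P.Λ) : Pf P (ℓ + 189) (disj a (disj b (disj c d))) := by
  have h1 : Pf P (ℓ + 31) (disj a (disj d (disj b c))) :=
    genComm h ha (Pc.disj hb hc) hd hka (by omega) (by omega) (by omega)
  have h2 : Pf P (ℓ + 31 + 48) (disj a (disj (disj d b) c)) :=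
    genAssoc h1 ha hd hb hc hka (by omega) (by omega) (by omega) (by omega)
  have h3 : Pf P (ℓ + 31 + 48 + 31) (disj a (disj c (disj d b))) :=
    genComm h2 ha (Pc.disj hd hb) hc hka (by omega) (by omega) (by omega)
  have h4 : Pf P (ℓ + 31 + 48 + 31 + 48) (disj a (disj (disj c d) b)) :=
    genAssoc h3 ha hc hd hb hka (by omega) (by omega) (by omega) (by omega)
  have h5 := genComm h4 ha (Pc.disj hc hd) hb hka (by omega) (by omega) (by omega)
  exact h5.mono (by omega)

/-- Removing a trailing `⊥`: `A ∨ ⊥ ⊢ A` (8 lines). [folklore] -/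
theorem removeBot (h : Pf P ℓ (disj a (const false))) (ha : Pc P ka na a)
    (hka : ka ≤ 11) (hn : 2 * na + 1 ≤ P.Λ) : Pf P (ℓ + 8) a := by
  have h1 : Pf P (ℓ + 2) (disj (const false) a) := comm h ha Pc.bot hka (by omega) (by omega)
  have h2 : Pf P 1 (neg (const false)) := negBot (by omega)
  have h3 : Pf P 2 (disj a (neg (const false))) := expan a h2 (by apply LineOK.mk'; (repeat (first | assumption | exact Pc.bot | apply Pc.disj | apply Pc.neg)); all_goals omega)
  have h4 : Pf P 4 (disj (neg (const false)) a) := comm h3 ha (Pc.neg Pc.bot) hka (by omega) (by omega)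
  have h5 := cut h1 h4 (by apply LineOK.mk'; (repeat (first | assumption | exact Pc.bot | apply Pc.disj | apply Pc.neg)); all_goals omega)
  have h6 := contr h5 (by apply LineOK.mk'; (repeat (first | assumption | exact Pc.bot | apply Pc.disj | apply Pc.neg)); all_goals omega)
  exact h6.mono (by omega)

/-- Exchange in context: `X ∨ (A ∨ (B ∨ T)) ⊢ X ∨ (B ∨ (A ∨ T))` (260 lines). [folklore] -/
theorem exch {x t : PropForm ℕ} {kx nx kt nt : ℕ} (h : Pf P ℓ (disj x (disj a (disj b t))))
    (hx : Pc P kx nx x) (ha : Pc P ka na a) (hb : Pc P kb nb b) (ht : Pc P kt nt t)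
    (hkx : kx ≤ 10) (hka : ka ≤ 10) (hkb : kb ≤ 10) (hkt : kt ≤ 10)
    (hn : 4 * (nx + na + nb + nt) ≤ P.Λ) : Pf P (ℓ + 260) (disj x (disj b (disj a t))) := by
  have h1 : Pf P (ℓ + 31) (disj x (disj (disj b t) a)) :=
    genComm h hx ha (Pc.disj hb ht) (by omega) hka (by omega) (by omega)
  have h2 : Pf P (ℓ + 31 + 189) (disj x (disj b (disj t a))) :=
    genAssoc' h1 hx hb ht ha (by omega) hkb hkt hka (by omega)
  have h3 : Pf P (ℓ + 31 + 189 + 1) (disj (disj x b) (disj t a)) := assoc h2 (by apply LineOK.mk'; (repeat (first | assumption | exact Pc.bot | apply Pc.disj | apply Pc.neg)); all_goals omega)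
  have h4 : Pf P (ℓ + 31 + 189 + 1 + 31) (disj (disj x b) (disj a t)) :=
    genComm h3 (Pc.disj hx hb) ht ha (by omega) hkt (by omega) (by omega)
  have h5 := assoc' h4 hx hb (Pc.disj ha ht) (by omega) (by omega) (by omega) (by omega)
  exact h5.mono (by omega)

/-- Contraction in context: `X ∨ (A ∨ (A ∨ T)) ⊢ X ∨ (A ∨ T)` (125 lines). [folklore] -/
theorem ctnCtx {x t : PropForm ℕ} {kx nx kt nt : ℕ} (h : Pf P ℓ (disj x (disj a (disj a t))))
    (hx : Pc P kx nx x) (ha : Pc P ka na a) (ht : Pc P kt nt t)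
    (hkx : kx ≤ 10) (hka : ka ≤ 10) (hkt : kt ≤ 10)
    (hn : 8 * (nx + na + nt) ≤ P.Λ) : Pf P (ℓ + 125) (disj x (disj a t)) := by
  have h1 : Pf P (ℓ + 48) (disj x (disj (disj a a) t)) :=
    genAssoc h hx ha ha ht (by omega) (by omega) (by omega) (by omega) (by omega)
  have h2 : Pf P (ℓ + 48 + 31) (disj x (disj t (disj a a))) :=
    genComm h1 hx (Pc.disj ha ha) ht (by omega) (by omega) (by omega) (by omega)
  have h3 : Pf P (ℓ + 48 + 31 + 1) (disj (disj x t) (disj a a)) := assoc h2 (by apply LineOK.mk'; (repeat (first | assumption | exact Pc.bot | apply Pc.disj | apply Pc.neg)); all_goals omega)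
  have h4 : Pf P (ℓ + 48 + 31 + 1 + 6) (disj (disj x t) a) :=
    genCtn h3 (Pc.disj hx ht) ha (by omega) (by omega) (by omega)
  have h5 : Pf P (ℓ + 48 + 31 + 1 + 6 + 8) (disj x (disj t a)) :=
    assoc' h4 hx ht ha (by omega) (by omega) (by omega) (by omega)
  have h6 := genComm h5 hx ht ha (by omega) hkt (by omega) (by omega)
  exact h6.mono (by omega)

/-- A two-element list disjunction from a binary disjunction: `A ∨ B ⊢ A ∨ (B ∨ ⊥)` (7 lines). [folklore] -/
theorem disjPair (h : Pf P ℓ (disj a b)) (ha : Pc P ka na a) (hb : Pc P kb nb b)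
    (hka : ka ≤ 11) (hkb : kb ≤ 11) (hn : 2 * (na + nb) + 2 ≤ P.Λ) :
    Pf P (ℓ + 7) (disj a (disj b (const false))) := by
  have h1 : Pf P (ℓ + 1) (disj (const false) (disj a b)) := expan (const false) h (by apply LineOK.mk'; (repeat (first | assumption | exact Pc.bot | apply Pc.disj | apply Pc.neg)); all_goals omega)
  have h2 : Pf P (ℓ + 2) (disj (disj (const false) a) b) := assoc h1 (by apply LineOK.mk'; (repeat (first | assumption | exact Pc.bot | apply Pc.disj | apply Pc.neg)); all_goals omega)
  have h3 : Pf P (ℓ + 4) (disj b (disj (const false) a)) :=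
    comm h2 (Pc.disj Pc.bot ha) hb (by omega) (by omega) (by omega)
  have h4 : Pf P (ℓ + 5) (disj (disj b (const false)) a) := assoc h3 (by apply LineOK.mk'; (repeat (first | assumption | exact Pc.bot | apply Pc.disj | apply Pc.neg)); all_goals omega)
  exact comm h4 (Pc.disj hb Pc.bot) ha (by omega) (by omega) (by omega)

/-- Auxiliary lemma `Pc.cast` (bounded-depth Frege toolkit / Pudlák–Krajíček construction, see the section header). [folklore] -/
theorem Pc.cast {k k' n n' : ℕ} {ψ : PropForm ℕ} (h : Pc P k n ψ) (hk : k = k') (hn : n = n') :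
    Pc P k' n' ψ := by
  subst hk hn; exact h

/-- Auxiliary lemma `Pc.disjList` (bounded-depth Frege toolkit / Pudlák–Krajíček construction, see the section header). [folklore] -/
theorem Pc.disjList {L : List (PropForm ℕ)} (hL : ∀ B ∈ L, Pc P 0 1 B) :
    Pc P 0 (L.length + 1) (disjList L) := by
  induction L with
  | nil => exact Pc.bot
  | cons B L ih =>
    rw [disjList_cons]
    exact (Pc.disj (hL B List.mem_cons_self) (ih fun C hC => hL C (List.mem_cons_of_mem _ hC))).cast
      (by simp) (by simp; omega)

/-- Absorption in context: if `A ∈ L` then `X ∨ (A ∨ ⋁L) ⊢ X ∨ ⋁L` (`270·|L|` lines). [folklore] -/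
theorem absorb {A : PropForm ℕ} (hA : Pc P 0 1 A) :
    ∀ (L : List (PropForm ℕ)) {x : PropForm ℕ} {kx nx ℓ : ℕ}, A ∈ L → (∀ B ∈ L, Pc P 0 1 B) →
      Pc P kx nx x → kx ≤ 10 → 8 * (nx + L.length + 2) ≤ P.Λ →
      Pf P ℓ (disj x (disj A (disjList L))) → Pf P (ℓ + 270 * L.length) (disj x (disjList L))
  | [], _, _, _, _, hmem, _, _, _, _, _ => absurd hmem List.not_mem_nil
  | B :: L, x, kx, nx, ℓ, hmem, hL, hx, hkx, hn, h => by
    have hB : Pc P 0 1 B := hL B List.mem_cons_self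
    have hL' : ∀ C ∈ L, Pc P 0 1 C := fun C hC => hL C (List.mem_cons_of_mem _ hC)
    have hT := Pc.disjList hL'
    rw [disjList_cons] at h ⊢
    simp only [List.length_cons] at hn ⊢
    by_cases hAB : A = B
    · subst hAB
      have h1 := ctnCtx h hx hA hT hkx (by omega) (by omega) (by omega)
      exact h1.mono (by omega)
    · have hA' : A ∈ L := (List.mem_cons.1 hmem).resolve_left hAB
      have h1 : Pf P (ℓ + 260) (disj x (disj B (disj A (disjList L)))) :=
        exch h hx hA hB hT hkx (by omega) (by omega) (by omega) (by omega)
      have h2 : Pf P (ℓ + 261) (disj (disj x B) (disj A (disjList L))) := assoc h1 (by apply LineOK.mk'; (repeat (first | assumption | exact Pc.bot | apply Pc.disj | apply Pc.neg)); all_goals omega)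
      have h3 : Pf P (ℓ + 261 + 270 * L.length) (disj (disj x B) (disjList L)) :=
        absorb hA L hA' hL' (Pc.disj hx hB) (by omega) (by omega) h2
      have h4 := assoc' h3 hx hB hT (by omega) (by omega) (by omega) (by omega)
      exact h4.mono (by omega)

/-- Line budget of the structural lemma. [folklore] -/
def cSub (m m' : ℕ) : ℕ := 300 * (m + 1) * (m' + 1)

/-- Auxiliary lemma `cSub_succ` (bounded-depth Frege toolkit / Pudlák–Krajíček construction, see the section header). [folklore] -/
theorem cSub_succ (m m' : ℕ) : cSub (m + 1) m' = cSub m m' + 300 * (m' + 1) := by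
  simp only [cSub]; ring

/-- Auxiliary lemma `cSub_zero` (bounded-depth Frege toolkit / Pudlák–Krajíček construction, see the section header). [folklore] -/
theorem cSub_zero (m' : ℕ) : cSub 0 m' = 300 * (m' + 1) := by
  simp [cSub]

/-- Auxiliary lemma `cSub_mono` (bounded-depth Frege toolkit / Pudlák–Krajíček construction, see the section header). [folklore] -/
theorem cSub_mono {m m' w w' : ℕ} (hm : m ≤ w) (hm' : m' ≤ w') : cSub m m' ≤ cSub w w' := by
  unfold cSub
  exact Nat.mul_le_mul (Nat.mul_le_mul_left _ (by omega)) (by omega)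

/-- Structural lemma in context: if every member of `L` occurs in `L'` then
`X ∨ ⋁L ⊢ X ∨ ⋁L'` (`cSub |L| |L'|` lines). [folklore] -/
theorem subsetCtx (hΛ : 1 ≤ P.Λ) :
    ∀ (L : List (PropForm ℕ)) {L' : List (PropForm ℕ)} {x : PropForm ℕ} {kx nx ℓ : ℕ},
      (∀ A ∈ L, A ∈ L') → (∀ B ∈ L, Pc P 0 1 B) → (∀ B ∈ L', Pc P 0 1 B) →
      Pc P kx nx x → kx ≤ 10 → 8 * (nx + L.length + L'.length + 2) ≤ P.Λ →
      Pf P ℓ (disj x (disjList L)) → Pf P (ℓ + cSub L.length L'.length) (disj x (disjList L'))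
  | [], L', x, kx, nx, ℓ, _, _, hL', hx, hkx, hn, h => by
    have hT' := Pc.disjList hL'
    rw [disjList_nil] at h
    have h1 : Pf P (ℓ + 8) x := removeBot h hx (by omega) (by omega)
    have h2 := expan' (disjList L') h1 hx hT' (by omega) (by omega) (by omega)
    refine h2.mono ?_
    rw [List.length_nil, cSub_zero]; omega
  | A :: L, L', x, kx, nx, ℓ, hsub, hL, hL', hx, hkx, hn, h => by
    have hA : Pc P 0 1 A := hL A List.mem_cons_self
    have hLt : ∀ C ∈ L, Pc P 0 1 C := fun C hC => hL C (List.mem_cons_of_mem _ hC)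
    have hT := Pc.disjList hLt
    have hT' := Pc.disjList hL'
    rw [disjList_cons] at h
    simp only [List.length_cons] at hn ⊢
    have h1 : Pf P (ℓ + 1) (disj (disj x A) (disjList L)) := assoc h (by apply LineOK.mk'; (repeat (first | assumption | exact Pc.bot | apply Pc.disj | apply Pc.neg)); all_goals omega)
    have h2 : Pf P (ℓ + 1 + cSub L.length L'.length) (disj (disj x A) (disjList L')) :=
      subsetCtx hΛ L (fun B hB => hsub B (List.mem_cons_of_mem _ hB)) hLt hL' (Pc.disj hx hA)
        (by omega) (by omega) h1
    have h3 : Pf P (ℓ + 1 + cSub L.length L'.length + 8) (disj x (disj A (disjList L'))) :=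
      assoc' h2 hx hA hT' (by omega) (by omega) (by omega) (by omega)
    have h4 : Pf P (ℓ + 1 + cSub L.length L'.length + 8 + 270 * L'.length) (disj x (disjList L')) :=
      absorb hA L' (hsub A List.mem_cons_self) hL' hx hkx (by omega) h3
    refine h4.mono ?_
    rw [cSub_succ]; omega

/-- Structural lemma: if every member of `L` occurs in `L'` then `⋁L ⊢ ⋁L'`. [folklore] -/
theorem subset {L L' : List (PropForm ℕ)} (hsub : ∀ A ∈ L, A ∈ L') (hL : ∀ B ∈ L, Pc P 0 1 B)
    (hL' : ∀ B ∈ L', Pc P 0 1 B) (hn : 8 * (L.length + L'.length + 3) ≤ P.Λ)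
    (h : Pf P ℓ (disjList L)) : Pf P (ℓ + cSub L.length L'.length + 11) (disjList L') := by
  have hT := Pc.disjList hL
  have hT' := Pc.disjList hL'
  have h1 : Pf P (ℓ + 1) (disj (const false) (disjList L)) := expan (const false) h (by apply LineOK.mk'; (repeat (first | assumption | exact Pc.bot | apply Pc.disj | apply Pc.neg)); all_goals omega)
  have h2 : Pf P (ℓ + 1 + cSub L.length L'.length) (disj (const false) (disjList L')) :=
    subsetCtx (by omega) L hsub hL hL' Pc.bot (by omega) (by omega) h1
  have h3 : Pf P (ℓ + 1 + cSub L.length L'.length + 2) (disj (disjList L') (const false)) :=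
    comm h2 Pc.bot hT' (by omega) (by omega) (by omega)
  have h4 := removeBot h3 hT' (by omega) (by omega)
  exact h4.mono (by omega)

/-- Core of the `¬∨` rule: `¬B ∨ T, ¬C ∨ T ⊢ ¬(B ∨ C) ∨ T` (35 lines). [folklore] -/
theorem negDisjCore {b' c' t : PropForm ℕ} {kt nt kn nn : ℕ}
    (hB : Pf P ℓ₁ (disj (neg b') t)) (hC : Pf P ℓ₂ (disj (neg c') t))
    (hb : Pc P kb nb b') (hc : Pc P kc nc c') (ht : Pc P kt nt t)
    (hN : Pc P kn nn (neg (disj b' c')))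
    (hkb : kb ≤ 10) (hkc : kc ≤ 10) (hkt : kt ≤ 10) (hkn : kn ≤ 10)
    (hn : 4 * (nb + nc + nt + nn) ≤ P.Λ) :
    Pf P (ℓ₁ + ℓ₂ + 35) (disj (neg (disj b' c')) t) := by
  have s1 : Pf P 1 (disj (neg (disj b' c')) (disj b' c')) := ax (disj b' c') (by apply LineOK.mk'; (repeat (first | assumption | exact Pc.bot | apply Pc.disj | apply Pc.neg)); all_goals omega)
  have s2 : Pf P 3 (disj (disj b' c') (neg (disj b' c'))) :=
    comm s1 hN (Pc.disj hb hc) (by omega) (by omega) (by omega)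
  have s3 : Pf P 11 (disj b' (disj c' (neg (disj b' c')))) :=
    assoc' s2 hb hc hN (by omega) (by omega) (by omega) (by omega)
  have s4 : Pf P (11 + ℓ₁ + 1) (disj (disj c' (neg (disj b' c'))) t) := cut s3 hB (by apply LineOK.mk'; (repeat (first | assumption | exact Pc.bot | apply Pc.disj | apply Pc.neg)); all_goals omega)
  have s5 : Pf P (11 + ℓ₁ + 1 + 8) (disj c' (disj (neg (disj b' c')) t)) :=
    assoc' s4 hc hN ht (by omega) (by omega) (by omega) (by omega)
  have s6 : Pf P (11 + ℓ₁ + 1 + 8 + ℓ₂ + 1) (disj (disj (neg (disj b' c')) t) t) :=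
    cut s5 hC (by apply LineOK.mk'; (repeat (first | assumption | exact Pc.bot | apply Pc.disj | apply Pc.neg)); all_goals omega)
  have s7 : Pf P (11 + ℓ₁ + 1 + 8 + ℓ₂ + 1 + 8) (disj (neg (disj b' c')) (disj t t)) :=
    assoc' s6 hN ht ht (by omega) (by omega) (by omega) (by omega)
  have s8 := genCtn s7 hN ht (by omega) (by omega) (by omega)
  exact s8.mono (by omega)

end L1


/-! ### L2. Sequents -/

/-- Auxiliary lemma `altDepthAux_le_succ` (bounded-depth Frege toolkit / Pudlák–Krajíček construction, see the section header). [folklore] -/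
theorem altDepthAux_le_succ (c c' : ℕ) (ψ : PropForm ℕ) :
    altDepthAux c ψ ≤ altDepthAux c' ψ + 1 := by
  cases ψ <;> simp only [altDepthAux] <;> (first | omega | (split_ifs <;> omega))

/-- Auxiliary lemma `altDepth_neg_ge` (bounded-depth Frege toolkit / Pudlák–Krajíček construction, see the section header). [folklore] -/
theorem altDepth_neg_ge (φ : PropForm ℕ) : altDepth φ ≤ altDepth (neg φ) := by
  have h1 := altDepthAux_le_succ 0 1 φ
  show altDepthAux 0 φ ≤ altDepthAux 1 φ + (if (0 : ℕ) = 1 then 0 else 1)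
  rw [if_neg (by decide)]; exact h1

/-- Auxiliary lemma `altDepth_conj_ge_left` (bounded-depth Frege toolkit / Pudlák–Krajíček construction, see the section header). [folklore] -/
theorem altDepth_conj_ge_left (φ ψ : PropForm ℕ) : altDepth φ ≤ altDepth (conj φ ψ) := by
  have h1 := altDepthAux_le_succ 0 2 φ
  have h2 : altDepthAux 2 φ ≤ max (altDepthAux 2 φ) (altDepthAux 2 ψ) := le_max_left _ _
  show altDepthAux 0 φ ≤ max (altDepthAux 2 φ) (altDepthAux 2 ψ) + (if (0 : ℕ) = 2 then 0 else 1)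
  rw [if_neg (by decide)]; omega

/-- Auxiliary lemma `altDepth_conj_ge_right` (bounded-depth Frege toolkit / Pudlák–Krajíček construction, see the section header). [folklore] -/
theorem altDepth_conj_ge_right (φ ψ : PropForm ℕ) : altDepth ψ ≤ altDepth (conj φ ψ) := by
  have h1 := altDepthAux_le_succ 0 2 ψ
  have h2 : altDepthAux 2 ψ ≤ max (altDepthAux 2 φ) (altDepthAux 2 ψ) := le_max_right _ _
  show altDepthAux 0 ψ ≤ max (altDepthAux 2 φ) (altDepthAux 2 ψ) + (if (0 : ℕ) = 2 then 0 else 1)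
  rw [if_neg (by decide)]; omega

/-- Auxiliary lemma `altDepth_disj_ge_left` (bounded-depth Frege toolkit / Pudlák–Krajíček construction, see the section header). [folklore] -/
theorem altDepth_disj_ge_left (φ ψ : PropForm ℕ) : altDepth φ ≤ altDepth (disj φ ψ) := by
  have h1 := altDepthAux_le_succ 0 3 φ
  have h2 : altDepthAux 3 φ ≤ max (altDepthAux 3 φ) (altDepthAux 3 ψ) := le_max_left _ _
  show altDepthAux 0 φ ≤ max (altDepthAux 3 φ) (altDepthAux 3 ψ) + (if (0 : ℕ) = 3 then 0 else 1)
  rw [if_neg (by decide)]; omega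

/-- Auxiliary lemma `altDepth_disj_ge_right` (bounded-depth Frege toolkit / Pudlák–Krajíček construction, see the section header). [folklore] -/
theorem altDepth_disj_ge_right (φ ψ : PropForm ℕ) : altDepth ψ ≤ altDepth (disj φ ψ) := by
  have h1 := altDepthAux_le_succ 0 3 ψ
  have h2 : altDepthAux 3 ψ ≤ max (altDepthAux 3 φ) (altDepthAux 3 ψ) := le_max_right _ _
  show altDepthAux 0 ψ ≤ max (altDepthAux 3 φ) (altDepthAux 3 ψ) + (if (0 : ℕ) = 3 then 0 else 1)
  rw [if_neg (by decide)]; omega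

/-- Sequent-level parameters: line parameters plus a bound `W` on sequent lengths. [folklore] -/
structure SPrm extends Prm where
  /-- maximal length of a sequent -/
  W : ℕ
  /-- `hΛ` -/
  hΛ : 64 * (W + 4) ≤ Λ
  /-- `hM` -/
  hM : 2 ≤ M
  /-- `hD` -/
  hD : 2 ≤ D

/-- Lines per tick. [folklore] -/
def κ (Q : SPrm) : ℕ := cSub (Q.W + 2) (Q.W + 2) + 100

/-- Base formulas (admissible sequent members). [folklore] -/
def Base (Q : SPrm) (A : PropForm ℕ) : Prop := A.altDepth ≤ Q.D ∧ A.size ≤ Q.M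

section L2

variable {Q : SPrm} {A B C : PropForm ℕ} {L L' : List (PropForm ℕ)} {t t₁ t₂ : ℕ}

/-- Auxiliary lemma `Base.pc` (bounded-depth Frege toolkit / Pudlák–Krajíček construction, see the section header). [folklore] -/
theorem Base.pc (h : Base Q A) : Pc Q.toPrm 0 1 A := Pc.base h.1 h.2

/-- Auxiliary lemma `Base.of_neg` (bounded-depth Frege toolkit / Pudlák–Krajíček construction, see the section header). [folklore] -/
theorem Base.of_neg (h : Base Q (neg A)) : Base Q A :=
  ⟨(altDepth_neg_ge A).trans h.1, by have := h.2; simp [size] at this; omega⟩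

/-- Auxiliary lemma `Base.of_conj_left` (bounded-depth Frege toolkit / Pudlák–Krajíček construction, see the section header). [folklore] -/
theorem Base.of_conj_left (h : Base Q (conj A B)) : Base Q A :=
  ⟨(altDepth_conj_ge_left A B).trans h.1, by have := h.2; simp [size] at this; omega⟩

/-- Auxiliary lemma `Base.of_conj_right` (bounded-depth Frege toolkit / Pudlák–Krajíček construction, see the section header). [folklore] -/
theorem Base.of_conj_right (h : Base Q (conj A B)) : Base Q B :=
  ⟨(altDepth_conj_ge_right A B).trans h.1, by have := h.2; simp [size] at this; omega⟩

/-- Auxiliary lemma `Base.of_disj_left` (bounded-depth Frege toolkit / Pudlák–Krajíček construction, see the section header). [folklore] -/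
theorem Base.of_disj_left (h : Base Q (disj A B)) : Base Q A :=
  ⟨(altDepth_disj_ge_left A B).trans h.1, by have := h.2; simp [size] at this; omega⟩

/-- Auxiliary lemma `Base.of_disj_right` (bounded-depth Frege toolkit / Pudlák–Krajíček construction, see the section header). [folklore] -/
theorem Base.of_disj_right (h : Base Q (disj A B)) : Base Q B :=
  ⟨(altDepth_disj_ge_right A B).trans h.1, by have := h.2; simp [size] at this; omega⟩

/-- Auxiliary lemma `Base.top` (bounded-depth Frege toolkit / Pudlák–Krajíček construction, see the section header). [folklore] -/
theorem Base.top (Q : SPrm) : Base Q (const true) :=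
  ⟨by simp [altDepth, altDepthAux], by have := Q.hM; simp [size]; omega⟩

/-- Auxiliary lemma `Base.bot` (bounded-depth Frege toolkit / Pudlák–Krajíček construction, see the section header). [folklore] -/
theorem Base.bot (Q : SPrm) : Base Q (const false) :=
  ⟨by simp [altDepth, altDepthAux], by have := Q.hM; simp [size]; omega⟩

/-- Auxiliary lemma `Base.negBot` (bounded-depth Frege toolkit / Pudlák–Krajíček construction, see the section header). [folklore] -/
theorem Base.negBot (Q : SPrm) : Base Q (neg (const false)) :=
  ⟨by have := Q.hD; simp [altDepth, altDepthAux]; omega, by have := Q.hM; simp [size]; omega⟩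

/-- Auxiliary lemma `Base.negTop` (bounded-depth Frege toolkit / Pudlák–Krajíček construction, see the section header). [folklore] -/
theorem Base.negTop (Q : SPrm) : Base Q (neg (const true)) :=
  ⟨by have := Q.hD; simp [altDepth, altDepthAux]; omega, by have := Q.hM; simp [size]; omega⟩

/-- `Sq Q t L`: the sequent `⋁L` has a bounded proof of at most `t · κ` lines; all members are
base formulas and `|L| ≤ W`. [folklore] -/
def Sq (Q : SPrm) (t : ℕ) (L : List (PropForm ℕ)) : Prop :=
  (∀ A ∈ L, Base Q A) ∧ L.length ≤ Q.W ∧ Pf Q.toPrm (t * κ Q) (disjList L)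

/-- Auxiliary lemma `Sq.base` (bounded-depth Frege toolkit / Pudlák–Krajíček construction, see the section header). [folklore] -/
theorem Sq.base (h : Sq Q t L) : ∀ A ∈ L, Base Q A := h.1

/-- Auxiliary lemma `Sq.length_le` (bounded-depth Frege toolkit / Pudlák–Krajíček construction, see the section header). [folklore] -/
theorem Sq.length_le (h : Sq Q t L) : L.length ≤ Q.W := h.2.1

/-- Auxiliary lemma `Sq.pcL` (bounded-depth Frege toolkit / Pudlák–Krajíček construction, see the section header). [folklore] -/
theorem Sq.pcL (h : Sq Q t L) : ∀ A ∈ L, Pc Q.toPrm 0 1 A := fun A hA => (h.1 A hA).pc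

/-- Auxiliary lemma `Sq.mono` (bounded-depth Frege toolkit / Pudlák–Krajíček construction, see the section header). [folklore] -/
theorem Sq.mono {t' : ℕ} (h : Sq Q t L) (ht : t ≤ t') : Sq Q t' L :=
  ⟨h.1, h.2.1, h.2.2.mono (Nat.mul_le_mul_right _ ht)⟩

/-- Auxiliary lemma `κ_ge` (bounded-depth Frege toolkit / Pudlák–Krajíček construction, see the section header). [folklore] -/
theorem κ_ge (Q : SPrm) : 100 ≤ κ Q := by unfold κ; omega

/-- Auxiliary lemma `cSub_le_κ` (bounded-depth Frege toolkit / Pudlák–Krajíček construction, see the section header). [folklore] -/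
theorem cSub_le_κ {m m' : ℕ} (hm : m ≤ Q.W + 2) (hm' : m' ≤ Q.W + 2) : cSub m m' + 100 ≤ κ Q := by
  unfold κ; have := cSub_mono hm hm'; omega

/-- Weakening / exchange / contraction. [folklore] -/
theorem Sq.weaken (h : Sq Q t L) (hsub : ∀ A ∈ L, A ∈ L') (hL' : ∀ A ∈ L', Base Q A)
    (hW : L'.length ≤ Q.W) : Sq Q (t + 1) L' := by
  refine ⟨hL', hW, ?_⟩
  have hΛ := Q.hΛ
  have h1 := subset hsub h.pcL (fun A hA => (hL' A hA).pc) (by have := h.length_le; omega) h.2.2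
  refine h1.mono ?_
  have := cSub_le_κ (Q := Q) (m := L.length) (m' := L'.length) (by have := h.length_le; omega)
    (by omega)
  rw [Nat.add_mul, Nat.one_mul]; omega

/-- Logical axiom: a sequent containing `¬A` and `A`. [folklore] -/
theorem Sq.ax (hL : ∀ B ∈ L, Base Q B) (hW : L.length ≤ Q.W) (hA : A ∈ L) (hnA : neg A ∈ L) :
    Sq Q 1 L := by
  refine ⟨hL, hW, ?_⟩
  have hΛ := Q.hΛ
  have ha : Pc Q.toPrm 0 1 A := (hL A hA).pc
  have hna : Pc Q.toPrm 0 1 (neg A) := (hL _ hnA).pc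
  have h1 : Pf Q.toPrm 1 (disj (neg A) A) := DepthFrege.ax A (by apply LineOK.mk'; (repeat (first | assumption | exact Pc.bot | apply Pc.disj | apply Pc.neg)); all_goals omega)
  have h2 : Pf Q.toPrm 8 (disjList [neg A, A]) := disjPair h1 hna ha (by omega) (by omega) (by omega)
  have h3 := subset (L := [neg A, A]) (L' := L) (by simp [hA, hnA]) (by simp [ha, hna])
    (fun B hB => (hL B hB).pc) (by simp; omega) h2
  refine h3.mono ?_
  have := cSub_le_κ (Q := Q) (m := [neg A, A].length) (m' := L.length) (by simp) (by omega)
  omega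

/-- Axiom: a sequent containing `⊤`. [folklore] -/
theorem Sq.topMem (hL : ∀ B ∈ L, Base Q B) (hW : L.length ≤ Q.W) (hA : const true ∈ L) :
    Sq Q 1 L := by
  refine ⟨hL, hW, ?_⟩
  have hΛ := Q.hΛ
  have ht : Pc Q.toPrm 0 1 (const true) := (Base.top Q).pc
  have h1 : Pf Q.toPrm 1 (const true) := top (by have := Q.hM; omega) (by omega)
  have h2 : Pf Q.toPrm 4 (disjList [const true]) :=
    expan' (const false) h1 ht Pc.bot (by omega) (by omega) (by omega)
  have h3 := subset (L := [const true]) (L' := L) (by simp [hA]) (by simp [ht])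
    (fun B hB => (hL B hB).pc) (by simp; omega) h2
  refine h3.mono ?_
  have := cSub_le_κ (Q := Q) (m := [(const true : PropForm ℕ)].length) (m' := L.length) (by simp)
    (by omega)
  omega

/-- Axiom: a sequent containing `¬⊥`. [folklore] -/
theorem Sq.negBotMem (hL : ∀ B ∈ L, Base Q B) (hW : L.length ≤ Q.W) (hA : neg (const false) ∈ L) :
    Sq Q 1 L := by
  refine ⟨hL, hW, ?_⟩
  have hΛ := Q.hΛ
  have ht : Pc Q.toPrm 0 1 (neg (const false)) := (hL _ hA).pc
  have h1 : Pf Q.toPrm 1 (neg (const false)) := negBot (by omega)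
  have h2 : Pf Q.toPrm 4 (disjList [neg (const false)]) :=
    expan' (const false) h1 ht Pc.bot (by omega) (by omega) (by omega)
  have h3 := subset (L := [neg (const false)]) (L' := L) (by simp [hA]) (by simp [ht])
    (fun B hB => (hL B hB).pc) (by simp; omega) h2
  refine h3.mono ?_
  have := cSub_le_κ (Q := Q) (m := [(neg (const false) : PropForm ℕ)].length) (m' := L.length)
    (by simp) (by omega)
  omega

/-- `∨`-rule: `⋁(B :: C :: L) ⊢ ⋁((B ∨ C) :: L)`. [folklore] -/
theorem Sq.consDisj (h : Sq Q t (B :: C :: L)) (hBC : Base Q (disj B C)) :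
    Sq Q (t + 1) (disj B C :: L) := by
  have hB : Pc Q.toPrm 0 1 B := (h.base B (by simp)).pc
  have hC : Pc Q.toPrm 0 1 C := (h.base C (by simp)).pc
  have hT := Pc.disjList (L := L) (fun A hA => h.pcL A (by simp [hA]))
  have hΛ := Q.hΛ
  have hlen := h.length_le
  simp only [List.length_cons] at hlen
  refine ⟨?_, by simp; omega, ?_⟩
  · intro A hA
    simp only [List.mem_cons] at hA
    rcases hA with rfl | hA
    · exact hBC
    · exact h.base A (by simp [hA])
  · have h0 := h.2.2
    simp only [disjList_cons] at h0 ⊢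
    have h1 := assoc h0 (by apply LineOK.mk'; (repeat (first | assumption | exact Pc.bot | apply Pc.disj | apply Pc.neg)); all_goals omega)
    refine h1.mono ?_
    have := κ_ge Q; rw [Nat.add_mul]; omega

/-- `¬¬`-rule: `⋁(B :: L) ⊢ ⋁(¬¬B :: L)`. [folklore] -/
theorem Sq.consNegNeg (h : Sq Q t (B :: L)) (hBB : Base Q (neg (neg B))) :
    Sq Q (t + 1) (neg (neg B) :: L) := by
  have hB : Pc Q.toPrm 0 1 B := (h.base B (by simp)).pc
  have hT := Pc.disjList (L := L) (fun A hA => h.pcL A (by simp [hA]))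
  have hΛ := Q.hΛ
  have hlen := h.length_le
  simp only [List.length_cons] at hlen
  refine ⟨?_, by simp; omega, ?_⟩
  · intro A hA
    simp only [List.mem_cons] at hA
    rcases hA with rfl | hA
    · exact hBB
    · exact h.base A (by simp [hA])
  · have h0 := h.2.2
    simp only [disjList_cons] at h0 ⊢
    have h1 := negNeg h0 hB hT (by omega) (by omega) (by omega)
    refine h1.mono ?_
    have := κ_ge Q; rw [Nat.add_mul]; omega

/-- `¬∨`-rule: `⋁(¬B :: L), ⋁(¬C :: L) ⊢ ⋁(¬(B ∨ C) :: L)`. [folklore] -/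
theorem Sq.consNegDisj (h₁ : Sq Q t₁ (neg B :: L)) (h₂ : Sq Q t₂ (neg C :: L))
    (hN : Base Q (neg (disj B C))) : Sq Q (t₁ + t₂ + 1) (neg (disj B C) :: L) := by
  have hB : Pc Q.toPrm 0 1 B := hN.of_neg.of_disj_left.pc
  have hC : Pc Q.toPrm 0 1 C := hN.of_neg.of_disj_right.pc
  have hNp : Pc Q.toPrm 0 1 (neg (disj B C)) := hN.pc
  have hT := Pc.disjList (L := L) (fun A hA => h₁.pcL A (by simp [hA]))
  have hΛ := Q.hΛ
  have hlen := h₁.length_le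
  simp only [List.length_cons] at hlen
  refine ⟨?_, by simp; omega, ?_⟩
  · intro A hA
    simp only [List.mem_cons] at hA
    rcases hA with rfl | hA
    · exact hN
    · exact h₁.base A (by simp [hA])
  · have e₁ := h₁.2.2
    have e₂ := h₂.2.2
    simp only [disjList_cons] at e₁ e₂ ⊢
    have h1 := negDisjCore e₁ e₂ hB hC hT hNp (by omega) (by omega) (by omega) (by omega)
      (by omega)
    refine h1.mono ?_
    have := κ_ge Q; simp only [Nat.add_mul]; omega

/-- `∧`-rule: `⋁(B :: L), ⋁(C :: L) ⊢ ⋁((B ∧ C) :: L)`. [folklore] -/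
theorem Sq.consConj (h₁ : Sq Q t₁ (B :: L)) (h₂ : Sq Q t₂ (C :: L)) (hN : Base Q (conj B C)) :
    Sq Q (t₁ + t₂ + 1) (conj B C :: L) := by
  have hB : Pc Q.toPrm 0 1 B := hN.of_conj_left.pc
  have hC : Pc Q.toPrm 0 1 C := hN.of_conj_right.pc
  have hNp : Pc Q.toPrm 0 1 (conj B C) := hN.pc
  have hT := Pc.disjList (L := L) (fun A hA => h₁.pcL A (by simp [hA]))
  have hΛ := Q.hΛ
  have hlen := h₁.length_le
  simp only [List.length_cons] at hlen
  refine ⟨?_, by simp; omega, ?_⟩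
  · intro A hA
    simp only [List.mem_cons] at hA
    rcases hA with rfl | hA
    · exact hN
    · exact h₁.base A (by simp [hA])
  · have e₁ := h₁.2.2
    have e₂ := h₂.2.2
    simp only [disjList_cons] at e₁ e₂ ⊢
    have f₁ : Pf Q.toPrm (t₁ * κ Q + 6) (disj (neg (neg B)) (disjList L)) :=
      negNeg e₁ hB hT (by omega) (by omega) (by omega)
    have f₂ : Pf Q.toPrm (t₂ * κ Q + 6) (disj (neg (neg C)) (disjList L)) :=
      negNeg e₂ hC hT (by omega) (by omega) (by omega)
    have hM : Pf Q.toPrm (t₁ * κ Q + 6 + (t₂ * κ Q + 6) + 35)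
        (disj (neg (disj (neg B) (neg C))) (disjList L)) :=
      negDisjCore f₁ f₂ (Pc.neg hB) (Pc.neg hC) hT (Pc.neg (Pc.disj (Pc.neg hB) (Pc.neg hC)))
        (by omega) (by omega) (by omega) (by omega) (by omega)
    have hax : Pf Q.toPrm 1 (disj (neg (neg (disj (neg B) (neg C)))) (conj B C)) :=
      conjAx₂ B C (by apply LineOK.mk'; (repeat (first | assumption | exact Pc.bot | apply Pc.disj | apply Pc.neg)); all_goals omega)
    have h3 := cut hM hax (by apply LineOK.mk'; (repeat (first | assumption | exact Pc.bot | apply Pc.disj | apply Pc.neg)); all_goals omega)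
    have h4 := comm h3 hT hNp (by omega) (by omega) (by omega)
    refine h4.mono ?_
    have := κ_ge Q; simp only [Nat.add_mul]; omega

/-- `¬∧`-rule: `⋁(¬B :: ¬C :: L) ⊢ ⋁(¬(B ∧ C) :: L)`. [folklore] -/
theorem Sq.consNegConj (h : Sq Q t (neg B :: neg C :: L)) (hN : Base Q (neg (conj B C))) :
    Sq Q (t + 1) (neg (conj B C) :: L) := by
  have hB : Pc Q.toPrm 0 1 B := hN.of_neg.of_conj_left.pc
  have hC : Pc Q.toPrm 0 1 C := hN.of_neg.of_conj_right.pc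
  have hBC : Pc Q.toPrm 0 1 (conj B C) := hN.of_neg.pc
  have hNp : Pc Q.toPrm 0 1 (neg (conj B C)) := hN.pc
  have hT := Pc.disjList (L := L) (fun A hA => h.pcL A (by simp [hA]))
  have hΛ := Q.hΛ
  have hlen := h.length_le
  simp only [List.length_cons] at hlen
  refine ⟨?_, by simp; omega, ?_⟩
  · intro A hA
    simp only [List.mem_cons] at hA
    rcases hA with rfl | hA
    · exact hN
    · exact h.base A (by simp [hA])
  · have h0 := h.2.2
    simp only [disjList_cons] at h0 ⊢
    have h1 : Pf Q.toPrm (t * κ Q + 1) (disj (disj (neg B) (neg C)) (disjList L)) :=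
      assoc h0 (by apply LineOK.mk'; (repeat (first | assumption | exact Pc.bot | apply Pc.disj | apply Pc.neg)); all_goals omega)
    have hax : Pf Q.toPrm 1 (disj (neg (conj B C)) (neg (disj (neg B) (neg C)))) :=
      conjAx₁ B C (by apply LineOK.mk'; (repeat (first | assumption | exact Pc.bot | apply Pc.disj | apply Pc.neg)); all_goals omega)
    have h2 : Pf Q.toPrm 3 (disj (neg (disj (neg B) (neg C))) (neg (conj B C))) :=
      comm hax hNp (Pc.neg (Pc.disj (Pc.neg hB) (Pc.neg hC))) (by omega) (by omega) (by omega)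
    have h3 := cut h1 h2 (by apply LineOK.mk'; (repeat (first | assumption | exact Pc.bot | apply Pc.disj | apply Pc.neg)); all_goals omega)
    have h4 := comm h3 hT hNp (by omega) (by omega) (by omega)
    refine h4.mono ?_
    have := κ_ge Q; simp only [Nat.add_mul]; omega

/-- Cut on the head formula. [folklore] -/
theorem Sq.cut (h₁ : Sq Q t₁ (A :: L)) (h₂ : Sq Q t₂ (neg A :: L)) : Sq Q (t₁ + t₂ + 1) L := by
  have hT := Pc.disjList (L := L) (fun B hB => h₁.pcL B (by simp [hB]))
  have hΛ := Q.hΛ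
  have hlen := h₁.length_le
  simp only [List.length_cons] at hlen
  refine ⟨fun B hB => h₁.base B (by simp [hB]), by omega, ?_⟩
  have e₁ := h₁.2.2
  have e₂ := h₂.2.2
  simp only [disjList_cons] at e₁ e₂
  have h1 := DepthFrege.cut e₁ e₂ (by apply LineOK.mk'; (repeat (first | assumption | exact Pc.bot | apply Pc.disj | apply Pc.neg)); all_goals omega)
  have h2 := contr h1 (by apply LineOK.mk'; (repeat (first | assumption | exact Pc.bot | apply Pc.disj | apply Pc.neg)); all_goals omega)
  refine h2.mono ?_
  have := κ_ge Q; simp only [Nat.add_mul]; omega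

/-- Extracting the proof of a one-formula sequent. [folklore] -/
theorem Sq.toPf (h : Sq Q t [A]) : Pf Q.toPrm (t * κ Q + 8) A := by
  have hA : Pc Q.toPrm 0 1 A := (h.base A (by simp)).pc
  have hΛ := Q.hΛ
  have e := h.2.2
  simp only [disjList_cons, disjList_nil] at e
  exact removeBot e hA (by omega) (by omega)

end L2


/-! ### L4. Macros on sequents -/

section L4

variable {Q : SPrm} {A B C : PropForm ℕ} {L L' Γ : List (PropForm ℕ)} {t t₁ t₂ t' : ℕ}

/-- Auxiliary lemma `Base.neg_of_negConj_left` (bounded-depth Frege toolkit / Pudlák–Krajíček construction, see the section header). [folklore] -/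
theorem Base.neg_of_negConj_left (h : Base Q (neg (conj A B))) : Base Q (neg A) := by
  refine ⟨?_, by have := h.2; simp [size] at this ⊢; omega⟩
  have h1 := h.1
  have h2 := altDepthAux_le_succ 1 2 A
  have h3 : altDepthAux 2 A ≤ max (altDepthAux 2 A) (altDepthAux 2 B) := le_max_left _ _
  simp only [altDepth, altDepthAux, show (0 : ℕ) ≠ 1 from by decide, show (1 : ℕ) ≠ 2 from by decide,
    if_false] at h1 ⊢
  omega

/-- Auxiliary lemma `Base.neg_of_negConj_right` (bounded-depth Frege toolkit / Pudlák–Krajíček construction, see the section header). [folklore] -/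
theorem Base.neg_of_negConj_right (h : Base Q (neg (conj A B))) : Base Q (neg B) := by
  refine ⟨?_, by have := h.2; simp [size] at this ⊢; omega⟩
  have h1 := h.1
  have h2 := altDepthAux_le_succ 1 2 B
  have h3 : altDepthAux 2 B ≤ max (altDepthAux 2 A) (altDepthAux 2 B) := le_max_right _ _
  simp only [altDepth, altDepthAux, show (0 : ℕ) ≠ 1 from by decide, show (1 : ℕ) ≠ 2 from by decide,
    if_false] at h1 ⊢
  omega

/-- Auxiliary lemma `Base.neg_of_negDisj_left` (bounded-depth Frege toolkit / Pudlák–Krajíček construction, see the section header). [folklore] -/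
theorem Base.neg_of_negDisj_left (h : Base Q (neg (disj A B))) : Base Q (neg A) := by
  refine ⟨?_, by have := h.2; simp [size] at this ⊢; omega⟩
  have h1 := h.1
  have h2 := altDepthAux_le_succ 1 3 A
  have h3 : altDepthAux 3 A ≤ max (altDepthAux 3 A) (altDepthAux 3 B) := le_max_left _ _
  simp only [altDepth, altDepthAux, show (0 : ℕ) ≠ 1 from by decide, show (1 : ℕ) ≠ 3 from by decide,
    if_false] at h1 ⊢
  omega

/-- Auxiliary lemma `Base.neg_of_negDisj_right` (bounded-depth Frege toolkit / Pudlák–Krajíček construction, see the section header). [folklore] -/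
theorem Base.neg_of_negDisj_right (h : Base Q (neg (disj A B))) : Base Q (neg B) := by
  refine ⟨?_, by have := h.2; simp [size] at this ⊢; omega⟩
  have h1 := h.1
  have h2 := altDepthAux_le_succ 1 3 B
  have h3 : altDepthAux 3 B ≤ max (altDepthAux 3 A) (altDepthAux 3 B) := le_max_right _ _
  simp only [altDepth, altDepthAux, show (0 : ℕ) ≠ 1 from by decide, show (1 : ℕ) ≠ 3 from by decide,
    if_false] at h1 ⊢
  omega

/-- Weakening where the new members are listed with their base proofs. [folklore] -/
theorem Sq.weaken₂ (h : Sq Q t L) (L' : List (PropForm ℕ)) (hsub : ∀ A ∈ L, A ∈ L')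
    (hnew : ∀ A ∈ L', A ∈ L ∨ Base Q A) (hW : L'.length ≤ Q.W) : Sq Q (t + 1) L' :=
  h.weaken hsub (fun A hA => (hnew A hA).elim (h.base A) id) hW

/-- Multi-cut: remove the members of `Δ` one by one. [folklore] -/
theorem Sq.multiCut : ∀ (Δ : List (PropForm ℕ)) {Γ : List (PropForm ℕ)} {t t' : ℕ},
    Sq Q t (Δ ++ Γ) → (∀ δ ∈ Δ, Sq Q t' (neg δ :: Γ)) → Sq Q (t + Δ.length * (t' + 2)) Γ
  | [], Γ, t, t', h, _ => h.mono (by simp)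
  | δ :: Δ, Γ, t, t', h, hΔ => by
    have hlen := h.length_le
    simp only [List.cons_append, List.length_cons, List.length_append] at hlen
    have h1 : Sq Q (t' + 1) (neg δ :: (Δ ++ Γ)) :=
      (hΔ δ (by simp)).weaken₂ _ (by intro A hA; simp only [List.mem_cons, List.mem_append] at hA ⊢; tauto)
        (by
          intro A hA
          simp only [List.mem_cons, List.mem_append] at hA
          rcases hA with rfl | hA | hA
          · exact Or.inl (by simp)
          · exact Or.inr (h.base A (by simp [hA]))
          · exact Or.inl (by simp [hA]))
        (by simp; omega)
    have h2 : Sq Q (t + (t' + 1) + 1) (Δ ++ Γ) := Sq.cut h h1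
    have h3 := Sq.multiCut Δ h2 (fun δ' hδ' => hΔ δ' (by simp [hδ']))
    refine h3.mono ?_
    rw [List.length_cons, Nat.succ_mul]; omega

/-- A conjunction from its two (negated) parts present in the sequent. [folklore] -/
theorem Sq.conjParts (hL : ∀ B ∈ L, Base Q B) (hW : L.length + 1 ≤ Q.W) (hA : neg A ∈ L)
    (hB : neg B ∈ L) (hAB : conj A B ∈ L) : Sq Q 4 L := by
  have hAB' := hL _ hAB
  have e₁ : Sq Q 1 (A :: L) := Sq.ax (A := A) (by
      intro C hC; simp only [List.mem_cons] at hC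
      rcases hC with rfl | hC
      · exact hAB'.of_conj_left
      · exact hL C hC) (by simp; omega) (by simp) (by simp [hA])
  have e₂ : Sq Q 1 (B :: L) := Sq.ax (A := B) (by
      intro C hC; simp only [List.mem_cons] at hC
      rcases hC with rfl | hC
      · exact hAB'.of_conj_right
      · exact hL C hC) (by simp; omega) (by simp) (by simp [hB])
  have e₃ := Sq.consConj e₁ e₂ hAB'
  exact (e₃.weaken (by intro C hC; simp only [List.mem_cons] at hC; rcases hC with rfl | hC; exact hAB; exact hC)
    hL (by omega)).mono (by omega)

/-- Big `∧`-introduction. [folklore] -/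
theorem Sq.andIntro (hL : ∀ B ∈ L, Base Q B) (hW : L.length + 1 ≤ Q.W) :
    ∀ (As : List (PropForm ℕ)), Base Q (conjList As) → (∀ A ∈ As, Sq Q t (A :: L)) →
      Sq Q (As.length * (t + 1) + 1) (conjList As :: L)
  | [], _, _ => by
    rw [conjList_nil]
    refine (Sq.topMem (L := const true :: L) ?_ (by simp; omega) (by simp)).mono (by simp)
    intro C hC; simp only [List.mem_cons] at hC
    rcases hC with rfl | hC
    · exact Base.top Q
    · exact hL C hC
  | A :: As, hb, h => by
    rw [conjList_cons] at hb ⊢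
    have ih := Sq.andIntro hL hW As hb.of_conj_right (fun B hB => h B (by simp [hB]))
    have h1 := Sq.consConj (h A (by simp)) ih hb
    refine h1.mono ?_
    rw [List.length_cons, Nat.succ_mul]; omega

/-- `¬`-monotonicity along a big conjunction: from `¬A` infer `¬⋀As` when `A ∈ As`. [folklore] -/
theorem Sq.negAndOfMem (hW : L.length + 2 ≤ Q.W) :
    ∀ (As : List (PropForm ℕ)) {A : PropForm ℕ} {t : ℕ}, A ∈ As → Base Q (neg (conjList As)) →
      Sq Q t (neg A :: L) → Sq Q (t + 2 * As.length) (neg (conjList As) :: L)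
  | [], _, _, hmem, _, _ => absurd hmem List.not_mem_nil
  | B :: As, A, t, hmem, hb, h => by
    rw [conjList_cons] at hb ⊢
    have hbT : Base Q (neg (conjList As)) := hb.neg_of_negConj_right
    have hbB : Base Q (neg B) := hb.neg_of_negConj_left
    have hL : ∀ C ∈ L, Base Q C := fun C hC => h.base C (by simp [hC])
    by_cases hAB : A = B
    · subst hAB
      have h1 : Sq Q (t + 1) (neg A :: neg (conjList As) :: L) :=
        h.weaken₂ _ (by intro C hC; simp only [List.mem_cons] at hC ⊢; tauto)
          (by
            intro C hC; simp only [List.mem_cons] at hC ⊢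
            rcases hC with rfl | rfl | hC
            · exact Or.inl (Or.inl rfl)
            · exact Or.inr hbT
            · exact Or.inl (Or.inr hC))
          (by simp; omega)
      have h2 := Sq.consNegConj h1 hb
      refine h2.mono ?_
      simp; omega
    · have hA' : A ∈ As := (List.mem_cons.1 hmem).resolve_left hAB
      have ih := Sq.negAndOfMem hW As hA' hbT h
      have h1 : Sq Q (t + 2 * As.length + 1) (neg B :: neg (conjList As) :: L) :=
        ih.weaken₂ _ (by intro C hC; simp only [List.mem_cons] at hC ⊢; tauto)
          (by
            intro C hC; simp only [List.mem_cons] at hC ⊢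
            rcases hC with rfl | rfl | hC
            · exact Or.inr hbB
            · exact Or.inl (Or.inl rfl)
            · exact Or.inl (Or.inr hC))
          (by simp; omega)
      have h2 := Sq.consNegConj h1 hb
      refine h2.mono ?_
      simp; omega

/-- Left `¬∧`-weakening. [folklore] -/
theorem Sq.negConjOfLeft (h : Sq Q t (neg A :: L)) (hb : Base Q (neg (conj A B)))
    (hW : L.length + 2 ≤ Q.W) : Sq Q (t + 2) (neg (conj A B) :: L) := by
  have h1 : Sq Q (t + 1) (neg A :: neg B :: L) :=
    h.weaken₂ _ (by intro C hC; simp only [List.mem_cons] at hC ⊢; tauto)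
      (by
        intro C hC; simp only [List.mem_cons] at hC ⊢
        rcases hC with rfl | rfl | hC
        · exact Or.inl (Or.inl rfl)
        · exact Or.inr hb.neg_of_negConj_right
        · exact Or.inl (Or.inr hC))
      (by simp; omega)
  exact Sq.consNegConj h1 hb

/-- Right `¬∧`-weakening. [folklore] -/
theorem Sq.negConjOfRight (h : Sq Q t (neg B :: L)) (hb : Base Q (neg (conj A B)))
    (hW : L.length + 2 ≤ Q.W) : Sq Q (t + 2) (neg (conj A B) :: L) := by
  have h1 : Sq Q (t + 1) (neg A :: neg B :: L) :=
    h.weaken₂ _ (by intro C hC; simp only [List.mem_cons] at hC ⊢; tauto)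
      (by
        intro C hC; simp only [List.mem_cons] at hC ⊢
        rcases hC with rfl | rfl | hC
        · exact Or.inr hb.neg_of_negConj_left
        · exact Or.inl (Or.inl rfl)
        · exact Or.inl (Or.inr hC))
      (by simp; omega)
  exact Sq.consNegConj h1 hb

/-- Splitting a binary disjunction at the head into two members. [folklore] -/
theorem Sq.unDisj (h : Sq Q t (disj A B :: L)) (hW : L.length + 2 ≤ Q.W) :
    Sq Q (t + 1) (A :: B :: L) := by
  have hAB := h.base (disj A B) (by simp)
  have hA : Pc Q.toPrm 0 1 A := hAB.of_disj_left.pc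
  have hB : Pc Q.toPrm 0 1 B := hAB.of_disj_right.pc
  have hT := Pc.disjList (L := L) (fun C hC => h.pcL C (by simp [hC]))
  have hΛ := Q.hΛ
  have hlen := h.length_le
  simp only [List.length_cons] at hlen
  refine ⟨?_, by simp; omega, ?_⟩
  · intro C hC
    simp only [List.mem_cons] at hC
    rcases hC with rfl | rfl | hC
    · exact hAB.of_disj_left
    · exact hAB.of_disj_right
    · exact h.base C (by simp [hC])
  · have h0 := h.2.2
    simp only [disjList_cons] at h0 ⊢
    have h1 := assoc' h0 hA hB hT (by omega) (by omega) (by omega) (by omega)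
    refine h1.mono ?_
    have := κ_ge Q; rw [Nat.add_mul]; omega

/-- Splitting a list disjunction at the head into its members. [folklore] -/
theorem Sq.unDisjList : ∀ (As : List (PropForm ℕ)) {L : List (PropForm ℕ)} {t : ℕ},
    Sq Q t (disjList As :: L) → As.length + L.length + 1 ≤ Q.W → Sq Q (t + 3 * As.length + 3) (As ++ L)
  | [], L, t, h, hW => by
    rw [disjList_nil] at h
    have hL : ∀ C ∈ L, Base Q C := fun C hC => h.base C (by simp [hC])
    have h1 : Sq Q 1 (neg (const false) :: L) := Sq.negBotMem (by
        intro C hC; simp only [List.mem_cons] at hC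
        rcases hC with rfl | hC
        · exact Base.negBot Q
        · exact hL C hC) (by simp; simp at hW; omega) (by simp)
    exact (Sq.cut h h1).mono (by simp)
  | A :: As, L, t, h, hW => by
    rw [disjList_cons] at h
    simp only [List.length_cons] at hW
    have hL : ∀ C ∈ L, Base Q C := fun C hC => h.base C (by simp [hC])
    have h1 : Sq Q (t + 1) (A :: disjList As :: L) := Sq.unDisj h (by omega)
    have h2 : Sq Q (t + 2) (disjList As :: A :: L) :=
      h1.weaken₂ _ (by intro C hC; simp only [List.mem_cons] at hC ⊢; tauto)
        (by intro C hC; simp only [List.mem_cons] at hC ⊢; tauto) (by simp; omega)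
    have h3 : Sq Q (t + 2 + 3 * As.length + 3) (As ++ A :: L) := Sq.unDisjList As h2 (by simp; omega)
    have h4 := h3.weaken₂ (A :: (As ++ L))
      (by intro C hC; simp only [List.mem_cons, List.mem_append] at hC ⊢; tauto)
      (by intro C hC; simp only [List.mem_cons, List.mem_append] at hC ⊢; tauto) (by simp; omega)
    exact h4.mono (by simp; omega)

/-- Folding members into a right-nested disjunction ending in `X`. [folklore] -/
theorem Sq.foldOr : ∀ (As : List (PropForm ℕ)) {Pre L : List (PropForm ℕ)} {X : PropForm ℕ} {t : ℕ},
    Sq Q t (Pre ++ As ++ X :: L) → Base Q (As.foldr disj X) →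
      Sq Q (t + 3 * As.length) (Pre ++ As.foldr disj X :: L)
  | [], Pre, L, X, t, h, _ => by simpa using h
  | A :: As, Pre, L, X, t, h, hb => by
    simp only [List.foldr_cons] at hb ⊢
    have hlen := h.length_le
    simp only [List.length_append, List.length_cons] at hlen
    have h0 : Sq Q t ((Pre ++ [A]) ++ As ++ X :: L) := by simpa using h
    have ih := Sq.foldOr As h0 hb.of_disj_right
    have h1 : Sq Q (t + 3 * As.length + 1) (A :: As.foldr disj X :: (Pre ++ L)) :=
      ih.weaken₂ _ (by intro C hC; simp only [List.mem_cons, List.mem_append] at hC ⊢; tauto)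
        (by intro C hC; simp only [List.mem_cons, List.mem_append] at hC ⊢; tauto) (by simp; omega)
    have h2 := Sq.consDisj h1 hb
    have h3 := h2.weaken₂ (Pre ++ disj A (As.foldr disj X) :: L)
      (by intro C hC; simp only [List.mem_cons, List.mem_append] at hC ⊢; tauto)
      (by intro C hC; simp only [List.mem_cons, List.mem_append] at hC ⊢; tauto) (by simp; omega)
    refine h3.mono ?_
    simp only [List.length_cons]; omega

/-- Big `∨`-introduction: members `As` in front become the single member `⋁As`. [folklore] -/
theorem Sq.orIntro (As : List (PropForm ℕ)) (h : Sq Q t (As ++ L)) (hb : Base Q (disjList As))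
    (hW : As.length + L.length + 1 ≤ Q.W) : Sq Q (t + 3 * As.length + 1) (disjList As :: L) := by
  have h1 : Sq Q (t + 1) ([] ++ As ++ const false :: L) :=
    h.weaken₂ _ (by intro C hC; simp only [List.mem_cons, List.mem_append, List.nil_append] at hC ⊢; tauto)
      (by
        intro C hC; simp only [List.mem_cons, List.mem_append, List.nil_append] at hC ⊢
        rcases hC with hC | rfl | hC
        · exact Or.inl (Or.inl hC)
        · exact Or.inr (Base.bot Q)
        · exact Or.inl (Or.inr hC))
      (by simp; omega)
  have h2 := Sq.foldOr As h1 hb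
  simpa [disjList, Nat.add_assoc, Nat.add_comm, Nat.add_left_comm] using h2

end L4


end DepthFrege

end Literature.Computability.MetaComplexity
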